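import Mathlib
import Summits.Ventures.DiscreteObjects.Mahler.CensusResultantCutsDefect
import Summits.Ventures.DiscreteObjects.Mahler.CensusSearchCuts
import Summits.Ventures.DiscreteObjects.Mahler.LiouvilleInequality
import Summits.Ventures.DiscreteObjects.Mahler.CensusListPoly

/-!
# Resultant (arithmetic) power-sum cuts for the kernel census (venture `DiscreteObjects`, target L)

Cell `pub-namedobj`, seat `pub-namedobj-mahler-g14`. Framing: lottery ticket; floor = certified bounds/negative
ranges.

The Fejér–Riesz cuts of mahler g13 (`CensusTrigCuts`) say that for a reciprocal root configuration `s` (half-roots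
`α ≠ 0`, roots `α, α⁻¹`, `d = |s|`, `M ≤ B`) and an integer vector `v = (v₀,…,v_L)` with autocorrelations `λ₀, λ_k`:
`0 ≤ 2dλ₀ + Σ_k λ_k Re s_k + slack`.  They only use POSITIVITY of `|Q_v(e^{iθ})|²` (`Q_v(z) = Σ v_j z^j`).  Here we
add the ARITHMETIC information that `∏_{P(β)=0} Q_v(β) = ± Res(P, Q_v)` is a NONZERO INTEGER whenever `P ∈ ℤ[X]`
is irreducible of degree `> L` (no common root), which turns `≥ 0` into `≥ 2d`:

  `2d ≤ 2d·λ₀ + Σ_{k=1}^{L} λ_k · Re s_k + κ_m(B)²`,  `κ_m(B) = Σ_j |v_j| (B^{|j-m|} - B^{-|j-m|})` (any shift `m`)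

(`rcut_halfRoots`, with the hypothesis `1 ≤ ∏_{α∈s} ‖Q_v(α) Q_v(α⁻¹)‖`; `one_le_prod_norm_vEval_halfRoots` discharges it
for irreducible `P` via `Res(P, Q_v) ≠ 0`; `rcut_holds` is the integer form used by the search, `CutValidR` the validity
predicate of a table entry).  Proof: `Σ_α q̂(α) = dλ₀ + Σ_k (λ_k/2) s_k` (`laurent_vEval`); `∏_α ‖q̂(α)‖ = |Res| ≥ 1`
gives `Σ_α ‖q̂(α)‖ ≥ d` by `log x ≤ x - 1`; and `Σ_α (‖q̂(α)‖ - Re q̂(α)) ≤ ½ κ_m(B)²` (`CensusResultantCutsDefect`).  This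
is the single-polynomial (Jensen / AM–GM) case of the explicit-auxiliary-function bounds of Flammang–Rhin–Sac-Épée
(Math. Comp. 75 (2006) §3) and Mossinghoff–Rhin–Wu (2008): e.g. `v = (1,1)` gives `s₁ ≥ -d - 0.14` at `B = 13/10`
instead of the Toeplitz `s₁ ≥ -2d`; at degree 14–16 the search tree shrinks by a further factor ≈ 3.  Table check,
mixed Toeplitz/resultant validity and census verdicts: `CensusResultantCutsVerdict`.
-/

namespace Summit.Ventures.DiscreteObjects.Mahler

open Polynomial

/-! ## The cut -/

/-- `Σ log z ≤ Σ (z - 1)` in product form: if all `z_α > 0` and `1 ≤ ∏ z_α` then `|t| ≤ Σ z_α`. -/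
theorem card_le_sum_of_one_le_prod (t : Multiset ℝ) (hpos : ∀ z ∈ t, 0 < z) (hprod : 1 ≤ t.prod) :
    (Multiset.card t : ℝ) ≤ t.sum := by
  have hlog : ∀ u : Multiset ℝ, (∀ z ∈ u, 0 < z) → Real.log u.prod ≤ u.sum - Multiset.card u := by
    intro u
    induction u using Multiset.induction_on with
    | empty => intro _; simp
    | cons z u ih =>
      intro hu
      have hz : 0 < z := hu z (Multiset.mem_cons_self z u)
      have hu' : ∀ w ∈ u, 0 < w := fun w hw => hu w (Multiset.mem_cons_of_mem hw)
      have hup : 0 < u.prod := Multiset.prod_pos hu'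
      rw [Multiset.prod_cons, Multiset.sum_cons, Multiset.card_cons, Real.log_mul hz.ne' hup.ne']
      have := Real.log_le_sub_one_of_pos hz
      have := ih hu'
      push_cast; linarith
  have h0 : 0 ≤ Real.log t.prod := Real.log_nonneg hprod
  linarith [hlog t hpos]

/-- The roots of `∏_{α∈s}(x-α)(x-α⁻¹)` are `s + s⁻¹`. -/
theorem roots_halfRoots_prod (s : Multiset ℂ) :
    (s.map fun α => ((X - C α) * (X - C α⁻¹) : ℂ[X])).prod.roots = s + s.map (·⁻¹) := by
  induction s using Multiset.induction_on with
  | empty => simp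
  | cons a s ih =>
    rw [Multiset.map_cons, Multiset.prod_cons]
    have hne : ((X - C a) * (X - C a⁻¹)) * (s.map fun α => ((X - C α) * (X - C α⁻¹) : ℂ[X])).prod ≠ 0 := by
      apply mul_ne_zero (mul_ne_zero (X_sub_C_ne_zero a) (X_sub_C_ne_zero a⁻¹))
      intro h0
      rw [Multiset.prod_eq_zero_iff] at h0
      obtain ⟨α, _, hα⟩ := Multiset.mem_map.mp h0
      exact mul_ne_zero (X_sub_C_ne_zero α) (X_sub_C_ne_zero α⁻¹) hα
    rw [roots_mul hne, roots_mul (mul_ne_zero (X_sub_C_ne_zero a) (X_sub_C_ne_zero a⁻¹)),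
      roots_X_sub_C, roots_X_sub_C, ih, Multiset.map_cons]
    simp only [Multiset.singleton_add, Multiset.cons_add, Multiset.add_cons]
    rw [Multiset.cons_swap]

/-- Exchange of a multiset sum with a finite sum (complex values). -/
theorem multiset_sum_finset_sum_complex {ι : Type*} (s : Multiset ι) {n : ℕ} (f : ι → ℕ → ℂ) :
    (s.map fun i => ∑ k ∈ Finset.range n, f i k).sum = ∑ k ∈ Finset.range n, (s.map fun i => f i k).sum := by
  induction s using Multiset.induction_on with
  | empty => simp
  | cons a t ih => simp [Multiset.map_cons, Multiset.sum_cons, ih, Finset.sum_add_distrib]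

/-- **The resultant cut for a reciprocal root configuration.** For nonzero half-roots `s` (`d = |s|`) with
`M(∏(x-α)(x-α⁻¹)) ≤ B`, a real vector `v`, a shift `m`, and `1 ≤ ∏_{α∈s} ‖V(α)V(α⁻¹)‖`:
`2d ≤ 2d·λ₀ + Σ_k λ_k Re s_k + κ_m(B)²`. -/
theorem rcut_halfRoots (s : Multiset ℂ) (hs : ∀ α ∈ s, α ≠ 0) (v : List ℝ) (m : ℕ) {B : ℝ}
    (hB : (s.map fun α => ((X - C α) * (X - C α⁻¹) : ℂ[X])).prod.mahlerMeasure ≤ B)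
    (hres : 1 ≤ (s.map fun α => ‖vEval v α * vEval v α⁻¹‖).prod) :
    2 * (Multiset.card s : ℝ) ≤ 2 * (Multiset.card s : ℝ) * lamZero v +
      ∑ k ∈ Finset.range v.length, lamAt v (k + 1) * ((s.map fun α => α ^ (k + 1) + α⁻¹ ^ (k + 1)).sum).re +
      kappaR v m B ^ 2 := by
  -- (1) `Σ ‖q̂‖ ≥ d`
  have hpos : ∀ z ∈ (s.map fun α => ‖vEval v α * vEval v α⁻¹‖), 0 < z := by
    intro z hz
    obtain ⟨α, hα, rfl⟩ := Multiset.mem_map.mp hz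
    rcases (norm_nonneg (vEval v α * vEval v α⁻¹)).eq_or_lt with h | h
    · exfalso
      have h0 : (s.map fun α => ‖vEval v α * vEval v α⁻¹‖).prod = 0 :=
        Multiset.prod_eq_zero (Multiset.mem_map.mpr ⟨α, hα, h.symm⟩)
      rw [h0] at hres; exact absurd hres (by norm_num)
    · exact h
  have hsum1 := card_le_sum_of_one_le_prod _ hpos hres
  rw [Multiset.card_map] at hsum1
  -- (2) defect, summed: `Σ (‖q̂‖ - Re q̂) ≤ ½ Σ κ(R_α)² ≤ ½ κ(B)²`
  set P := (s.map fun α => ((X - C α) * (X - C α⁻¹) : ℂ[X])).prod with hP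
  have hmonic : P.Monic := by
    rw [hP]; apply monic_multiset_prod_of_monic; intro α _
    exact (monic_X_sub_C _).mul (monic_X_sub_C _)
  have hM1 : 1 ≤ P.mahlerMeasure := by
    apply one_le_mahlerMeasure_of_one_le_norm_leadingCoeff
    rw [hmonic.leadingCoeff, norm_one]
  have hRα : ∀ α ∈ s, max ‖α‖ ‖α‖⁻¹ = Real.exp |Real.log ‖α‖| := by
    intro α hα
    have hr : 0 < ‖α‖ := norm_pos_iff.mpr (hs α hα)
    rcases le_or_gt 1 ‖α‖ with h1 | h1
    · rw [max_eq_left ((inv_le_one_of_one_le₀ h1).trans h1), abs_of_nonneg (Real.log_nonneg h1), Real.exp_log hr]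
    · rw [max_eq_right (h1.le.trans (one_le_inv_iff₀.mpr ⟨hr, h1.le⟩)), abs_of_neg (Real.log_neg hr h1),
        Real.exp_neg, Real.exp_log hr]
  have hMprod : (s.map fun α => max ‖α‖ ‖α‖⁻¹).prod = P.mahlerMeasure := by
    rw [hP, mahlerMeasure_halfRoots s hs, exp_multiset_sum, Multiset.map_map]
    congr 1; exact Multiset.map_congr rfl hRα
  have hdef : (s.map fun α => ‖vEval v α * vEval v α⁻¹‖ - (vEval v α * vEval v α⁻¹).re).sum ≤ kappaR v m B ^ 2 / 2 := by
    calc (s.map fun α => ‖vEval v α * vEval v α⁻¹‖ - (vEval v α * vEval v α⁻¹).re).sum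
        ≤ (s.map fun α => kappaR v m (max ‖α‖ ‖α‖⁻¹) ^ 2 / 2).sum :=
          Multiset.sum_map_le_sum_map _ _ fun α hα => norm_sub_re_laurent_le v m (hs α hα)
      _ = ((s.map fun α => max ‖α‖ ‖α‖⁻¹).map fun R => kappaR v m R ^ 2).sum / 2 := by
          rw [Multiset.map_map, Multiset.sum_map_div]; rfl
      _ ≤ kappaR v m (s.map fun α => max ‖α‖ ‖α‖⁻¹).prod ^ 2 / 2 := by
          gcongr
          apply sum_kappaR_sq_le
          intro R hR
          obtain ⟨α, _, rfl⟩ := Multiset.mem_map.mp hR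
          exact le_max_iff.mpr (by
            rcases le_or_gt 1 ‖α‖ with h | h
            · exact Or.inl h
            · exact Or.inr (one_le_inv_iff₀.mpr ⟨norm_pos_iff.mpr (hs α ‹_›), h.le⟩))
      _ ≤ kappaR v m B ^ 2 / 2 := by
          rw [hMprod]
          have h0 := kappaR_nonneg v m hM1
          have h1 := kappaR_mono v m hM1 hB
          gcongr
  -- (3) the Laurent identity, summed
  have hsumq : (s.map fun α => vEval v α * vEval v α⁻¹).sum = (Multiset.card s : ℂ) * ((lamZero v : ℝ) : ℂ) +
      ∑ k ∈ Finset.range v.length, ((lamAt v (k + 1) / 2 : ℝ) : ℂ) * (s.map fun α => α ^ (k + 1) + α⁻¹ ^ (k + 1)).sum := by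
    have : (s.map fun α => vEval v α * vEval v α⁻¹) = s.map fun α => ((lamZero v : ℝ) : ℂ) +
        ∑ k ∈ Finset.range v.length, ((lamAt v (k + 1) / 2 : ℝ) : ℂ) * (α ^ (k + 1) + α⁻¹ ^ (k + 1)) :=
      Multiset.map_congr rfl fun α hα => laurent_vEval v (hs α hα)
    rw [this, Multiset.sum_map_add, Multiset.map_const', Multiset.sum_replicate, nsmul_eq_mul, multiset_sum_finset_sum_complex]
    congr 1
    apply Finset.sum_congr rfl
    intro k _
    rw [Multiset.sum_map_mul_left]
  have hre : ((s.map fun α => vEval v α * vEval v α⁻¹).sum).re =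
      (s.map fun α => (vEval v α * vEval v α⁻¹).re).sum := by
    have h := map_multiset_sum Complex.reAddGroupHom (s.map fun α => vEval v α * vEval v α⁻¹)
    rw [Multiset.map_map] at h
    exact h
  have hre2 : ((s.map fun α => vEval v α * vEval v α⁻¹).sum).re = (Multiset.card s : ℝ) * lamZero v +
      ∑ k ∈ Finset.range v.length, (lamAt v (k + 1) / 2) * ((s.map fun α => α ^ (k + 1) + α⁻¹ ^ (k + 1)).sum).re := by
    rw [hsumq, Complex.add_re, Complex.re_sum]
    congr 1
    · rw [show ((Multiset.card s : ℂ)) = ((Multiset.card s : ℝ) : ℂ) by norm_cast, ← Complex.ofReal_mul,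
        Complex.ofReal_re]
    · apply Finset.sum_congr rfl
      intro k _
      rw [Complex.re_ofReal_mul]
  have hsplit : (s.map fun α => (vEval v α * vEval v α⁻¹).re).sum =
      (s.map fun α => ‖vEval v α * vEval v α⁻¹‖).sum -
        (s.map fun α => ‖vEval v α * vEval v α⁻¹‖ - (vEval v α * vEval v α⁻¹).re).sum := by
    rw [Multiset.sum_map_sub]; ring
  have hmain : (Multiset.card s : ℝ) - kappaR v m B ^ 2 / 2 ≤ (Multiset.card s : ℝ) * lamZero v +
      ∑ k ∈ Finset.range v.length, (lamAt v (k + 1) / 2) * ((s.map fun α => α ^ (k + 1) + α⁻¹ ^ (k + 1)).sum).re := by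
    rw [← hre2, hre, hsplit]
    linarith
  have h2 : ∑ k ∈ Finset.range v.length, lamAt v (k + 1) * ((s.map fun α => α ^ (k + 1) + α⁻¹ ^ (k + 1)).sum).re =
      2 * ∑ k ∈ Finset.range v.length, (lamAt v (k + 1) / 2) * ((s.map fun α => α ^ (k + 1) + α⁻¹ ^ (k + 1)).sum).re := by
    rw [Finset.mul_sum]
    apply Finset.sum_congr rfl
    intro k _; ring
  rw [h2]
  linarith

/-! ## Integer polynomials: the resultant hypothesis and the cut -/

/-- `(ofCoeffs v)(z) = V(z)` over `ℂ`. -/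
theorem eval_map_ofCoeffs (v : List ℤ) (z : ℂ) :
    ((ofCoeffs v).map (Int.castRingHom ℂ)).eval z = vEval (v.map (Int.cast : ℤ → ℝ)) z := by
  induction v with
  | nil => simp [ofCoeffs_nil, vEval]
  | cons a w ih =>
    rw [ofCoeffs_cons, Polynomial.map_add, Polynomial.map_mul, map_X, map_C, eval_add, eval_mul, eval_X, eval_C,
      ih, List.map_cons, vEval]
    simp only [eq_intCast, Complex.ofReal_intCast]
    ring

/-- **The resultant hypothesis for irreducible `P`.** If `p ∈ ℤ[X]` is monic irreducible with
`p = ∏_{α∈s}(x-α)(x-α⁻¹)` over `ℂ`, and `v` (of length `≤ deg p`) has a nonzero entry, then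
`1 ≤ ∏_{α∈s} ‖V(α) V(α⁻¹)‖` (`= |Res(p, Q_v)|`). -/
theorem one_le_prod_norm_vEval_halfRoots {p : ℤ[X]} (hmonic : p.Monic) (hirr : Irreducible p) {s : Multiset ℂ}
    (hP : p.map (Int.castRingHom ℂ) = (s.map fun α => ((X - C α) * (X - C α⁻¹) : ℂ[X])).prod)
    (v : List ℤ) (hlen : v.length ≤ p.natDegree) (hnz : ∃ j, v.getD j 0 ≠ 0) :
    1 ≤ (s.map fun α => ‖vEval (v.map (Int.cast : ℤ → ℝ)) α * vEval (v.map (Int.cast : ℤ → ℝ)) α⁻¹‖).prod := by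
  obtain ⟨j, hj⟩ := hnz
  have hjlt : j < v.length := by
    by_contra h; push Not at h; exact hj (List.getD_eq_default _ _ h)
  set Q := ofCoeffs v with hQ
  have hQ0 : Q ≠ 0 := by
    intro h; apply hj; rw [← coeff_ofCoeffs, ← hQ, h, coeff_zero]
  have hQdeg : Q.natDegree < v.length := by
    rw [Nat.lt_iff_add_one_le]
    have : Q.natDegree ≤ v.length - 1 := by
      rw [natDegree_le_iff_coeff_eq_zero]
      intro N hN
      rw [hQ, coeff_ofCoeffs]
      exact List.getD_eq_default _ _ (by omega)
    omega
  have hd : 1 ≤ p.natDegree := by omega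
  have hndvd : ¬ p ∣ Q := by
    intro hdvd
    have := natDegree_le_of_dvd hdvd hQ0
    omega
  have hres := resultant_ne_zero_of_irreducible_of_not_dvd hirr hd hndvd (e := Q.natDegree) le_rfl
  have h1 : (1 : ℝ) ≤ ‖((p.resultant Q p.natDegree Q.natDegree : ℤ) : ℂ)‖ := by
    rw [Complex.norm_intCast]; exact_mod_cast Int.one_le_abs hres
  rw [resultant_intCast_eq (f := p) (G := Q) le_rfl, norm_mul, norm_pow, (hmonic.map _).leadingCoeff, norm_one,
    one_pow, one_mul, hP, roots_halfRoots_prod, Multiset.map_add, Multiset.prod_add, Multiset.map_map,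
    ← Multiset.prod_map_mul, ← normHom_apply, map_multiset_prod, Multiset.map_map] at h1
  refine h1.trans (le_of_eq ?_)
  congr 1
  apply Multiset.map_congr rfl
  intro α _
  simp only [Function.comp_apply, normHom_apply, norm_mul, hQ, eval_map_ofCoeffs]

/-- A resultant cut `([λ_k,…,λ_1], N)` at depth `k` is VALID for `(d, B)` if it comes from an integer vector `v` of
length `k+1 ≤ 2d` with a nonzero entry and a shift `m` with `2d·λ₀(v) - 2d + κ_m(v; B)² < N + 1`. -/
def CutValidR (d k : ℕ) (B : ℝ) (c : List ℤ × ℤ) : Prop :=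
  c.1.length = k ∧ ∃ (v : List ℤ) (m : ℕ), v.length = k + 1 ∧ k + 1 ≤ 2 * d ∧ (∃ j, v.getD j 0 ≠ 0) ∧
    (∀ j < k, c.1.getD (k - 1 - j) 0 = lamAt v (j + 1)) ∧
    2 * (d : ℝ) * ((lamZero v : ℤ) : ℝ) - 2 * (d : ℝ) + kappaR (v.map (Int.cast : ℤ → ℝ)) m B ^ 2 < (c.2 : ℝ) + 1

/-- **The resultant cuts hold for small-measure IRREDUCIBLE palindromic polynomials.** For monic irreducible
palindromic `p ∈ ℤ[X]` of degree `2d` with `M(p) < B` and a valid resultant cut `c` of depth `k`: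
`0 ≤ N + Σ_j λ_j P_j(p)`. -/
theorem rcut_holds {p : ℤ[X]} {d : ℕ} (hmonic : p.Monic) (hirr : Irreducible p) (hdeg : p.natDegree = 2 * d)
    (hpal : ∀ j ≤ 2 * d, p.coeff j = p.coeff (2 * d - j)) {B : ℝ} (hB : intMahlerMeasure p < B) {k : ℕ}
    {c : List ℤ × ℤ} (hc : CutValidR d k B c) :
    0 ≤ c.2 + (List.zipWith (· * ·) c.1 (psumsRev (descCoeffList p) k)).sum := by
  obtain ⟨-, v, m, hv, hk, hnz, hlam, hconst⟩ := hc
  obtain ⟨s', hcard, hs0, hP⟩ := palindromic_halfRoots_factorisation (p.map (Int.castRingHom ℂ)) d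
    (hmonic.map _) (by rw [natDegree_map_eq_of_injective (Int.castRingHom ℂ).injective_int, hdeg])
    (fun j hj => by rw [coeff_map, coeff_map, hpal j hj])
  have hB' : (s'.map fun α => ((X - C α) * (X - C α⁻¹) : ℂ[X])).prod.mahlerMeasure ≤ B := by
    rw [← hP]; exact hB.le
  have hres := one_le_prod_norm_vEval_halfRoots hmonic hirr hP v (by rw [hv, hdeg]; exact hk) hnz
  have hcut := rcut_halfRoots s' hs0 (v.map (Int.cast : ℤ → ℝ)) m hB' hres
  rw [hcard, List.length_map, hv, Finset.sum_range_succ, lamZero_map_cast] at hcut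
  simp only [lamAt_map_cast] at hcut
  rw [lamAt_eq_zero_of_le v (by omega)] at hcut
  simp only [Int.cast_zero, zero_mul, add_zero] at hcut
  have hre : ∀ j ∈ Finset.range k, ((s'.map fun α => α ^ (j + 1) + α⁻¹ ^ (j + 1)).sum).re =
      (((psumsRev (descCoeffList p) (j + 1)).getD 0 0 : ℤ) : ℝ) := by
    intro j _
    rw [← roots_powerSum_eq, ← hP, ← rootPowerSum_def, rootPowerSum_eq_head hmonic (by omega), Complex.intCast_re]
  rw [Finset.sum_congr rfl (fun j hj => by rw [hre j hj])] at hcut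
  rw [sum_zipWith_psumsRev c.1 _ k]
  have hsum : (((∑ j ∈ Finset.range k, c.1.getD (k - 1 - j) 0 * (psumsRev (descCoeffList p) (j + 1)).getD 0 0 : ℤ)) : ℝ)
      = ∑ j ∈ Finset.range k, ((lamAt v (j + 1) : ℤ) : ℝ) * (((psumsRev (descCoeffList p) (j + 1)).getD 0 0 : ℤ) : ℝ) := by
    push_cast
    apply Finset.sum_congr rfl
    intro j hj
    rw [Finset.mem_range] at hj
    rw [hlam j hj]
  have key : (-(c.2 + 1) : ℝ) <
      ((∑ j ∈ Finset.range k, c.1.getD (k - 1 - j) 0 * (psumsRev (descCoeffList p) (j + 1)).getD 0 0 : ℤ) : ℝ) := by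
    rw [hsum]
    linarith
  have key' : -(c.2 + 1) < ∑ j ∈ Finset.range k, c.1.getD (k - 1 - j) 0 * (psumsRev (descCoeffList p) (j + 1)).getD 0 0 := by
    exact_mod_cast key
  omega

end Summit.Ventures.DiscreteObjects.Mahler
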